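import Mathlib
import HarnessLib
import Literature.Probability.Process.PointStationaryLaw
import Literature.MathematicalPhysics.StatisticalMechanics.RootEnergy
import Summits.AtomisticToContinuum.Crystallization.Theses.BenjaminiSchrammPeriodicSupport

/-!
# Crux `GroundStatesChargePeriodic` (stmt-AtomisticToContinuum-2911) — the typed split of the hinge,
# assembly PROVED (crux-strategist workfile `Cruxes/GroundStatesChargePeriodic/Split.lean`, sorry-free)

We prove the assembly of the layer-2 decomposition of the shared finite-`N` hinge
`GroundStatesChargePeriodic` (item stmt-AtomisticToContinuum-2911) in route
`BenjaminiSchrammPeriodicSupport` (module importable by the registered lines of this crux and by the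
Theorems file that will close the route's glue item):

  `GroundStatesChargePeriodic_of_subs :
      PeriodicSupport → BenjaminiSchrammLimit → CrysEnergyLimit → GroundStatesChargePeriodic`,

and, as a corollary by definitional folding of the three landed notions
`Literature.Probability.Process.IsRootedHardCore`, `Literature.Probability.Process.IsPointStationaryLaw`
and `Literature.MathematicalPhysics.StatisticalMechanics.rootEnergy`, the route's glue item
`SupportToHinge` (stmt-AtomisticToContinuum-12748), whose middle antecedent is `BenjaminiSchrammLimit`
written through those notions.

Proof.  Given a sequence of Lennard-Jones ground states `x`, `BenjaminiSchrammLimit` supplies a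
subsequence `φ`, a hard core `δ > 0` and a point-stationary probability law `P` on rooted
`δ`-hard-core configurations with `E_P[h] = lim_j E(φ j)/φ j` together with the density-transfer
clause; `CrysEnergyLimit` along `φ` and uniqueness of limits give `E_P[h] = e* ≤ e*`, so `P` is
minimising and `PeriodicSupport` yields ONE periodic configuration `Q` whose two-way matching events
are charged at every scale.  For `R, ε > 0` let `T` be the matching event at radius `R + ε/2` and
tolerance `ε/2`; `P T > 0`, and with `ρ := P(T)/2 < P(T)` the transfer clause (radius `R + ε/2`,
tolerance `ε/2`) gives, for all large `j`, at least `ρ · φ j` particles `i` of `x^(φ j)` whose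
recentred configuration is `(R + ε/2, ε/2)`-matched both ways to some `ν ∈ T`; the deterministic
lemma `matched_periodic_of_matched_event` (two triangle inequalities, `‖A v‖ = ‖v‖`) upgrades each
such particle to one whose `R`-neighbourhood is `ε`-matched both ways with `x_i + A (Q.points - q)`;
monotonicity of `Nat.card` and "eventually along `φ` ⇒ frequently in `N`" finish.
No choice of scale depends on `ε ≤ 1`: the radii `R + ε/2` absorb the tolerance.

References: D. Aldous, J. M. Steele, *The objective method* (2004); D. Aldous, R. Lyons,
*Processes on unimodular random networks*, EJP 12 (2007) §2; X. Blanc, M. Lewin, EMS Surv. Math.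
Sci. 2 (2015) §2.1.
-/

namespace Summit.AtomisticToContinuum.Crystallization.Cruxes.GroundStatesChargePeriodic.Split

open scoped Topology ENNReal
open Filter Set MeasureTheory Literature.MathematicalPhysics.StatisticalMechanics
open Summit.AtomisticToContinuum.Crystallization.Theses.BenjaminiSchrammPeriodicSupport

/-! ## The deterministic matching step -/

/-- **From a matched charged configuration to a matched periodic pattern.**  If the configuration
`ν` is two-way `(ε/2)`-matched on the ball of radius `R + ε/2` with the rotated, re-based periodic
point set `A (Q.points - q)`, and the recentred finite configuration `{x k - x i}` is two-way
`(ε/2)`-matched on the ball of radius `R + ε/2` with the atoms of `ν`, then the `R`-neighbourhood of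
particle `i` is two-way `ε`-matched with `x i + A (Q.points - q)` — the matching clause of
`GroundStatesChargePeriodic`. [folklore] -/
theorem matched_periodic_of_matched_event {N : ℕ} (x : Fin N → EuclideanSpace ℝ (Fin 3))
    (i : Fin N) (Q : PeriodicConfiguration 3) {R ε : ℝ} (hε : 0 ≤ ε)
    (ν : Measure (EuclideanSpace ℝ (Fin 3)))
    (A : EuclideanSpace ℝ (Fin 3) →ₗᵢ[ℝ] EuclideanSpace ℝ (Fin 3))
    {q : EuclideanSpace ℝ (Fin 3)}
    (hQ1 : ∀ s ∈ Q.points, dist s q ≤ R + ε / 2 →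
      ∃ y : EuclideanSpace ℝ (Fin 3), ν {y} ≠ 0 ∧ dist y (A (s - q)) ≤ ε / 2)
    (hQ2 : ∀ y : EuclideanSpace ℝ (Fin 3), ν {y} ≠ 0 → ‖y‖ ≤ R + ε / 2 →
      ∃ s ∈ Q.points, dist y (A (s - q)) ≤ ε / 2)
    (h1 : ∀ p : EuclideanSpace ℝ (Fin 3), ν {p} ≠ 0 → ‖p‖ ≤ R + ε / 2 →
      ∃ q' ∈ Set.range (fun k : Fin N => x k - x i), dist q' p ≤ ε / 2)
    (h2 : ∀ q' ∈ Set.range (fun k : Fin N => x k - x i), ‖q'‖ ≤ R + ε / 2 →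
      ∃ p : EuclideanSpace ℝ (Fin 3), ν {p} ≠ 0 ∧ dist q' p ≤ ε / 2) :
    (∀ s ∈ Q.points, dist s q ≤ R → ∃ j : Fin N, dist (x j) (x i + A (s - q)) ≤ ε) ∧
      (∀ j : Fin N, dist (x j) (x i) ≤ R → ∃ s ∈ Q.points, dist (x j) (x i + A (s - q)) ≤ ε) := by
  have hkey : ∀ (j : Fin N) (s : EuclideanSpace ℝ (Fin 3)),
      dist (x j) (x i + A (s - q)) = dist (x j - x i) (A (s - q)) := by
    intro j s
    rw [dist_eq_norm, dist_eq_norm, sub_add_eq_sub_sub]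
  have hnA : ∀ s : EuclideanSpace ℝ (Fin 3), ‖A (s - q)‖ = dist s q := by
    intro s
    rw [LinearIsometry.norm_map, dist_eq_norm]
  constructor
  · intro s hs hsR
    obtain ⟨y, hy, hyd⟩ := hQ1 s hs (by linarith)
    have hyn : ‖y‖ ≤ R + ε / 2 := by
      calc ‖y‖ = dist y 0 := (dist_zero_right _).symm
        _ ≤ dist y (A (s - q)) + dist (A (s - q)) 0 := dist_triangle _ _ _
        _ ≤ ε / 2 + R := by
            rw [dist_zero_right, hnA]; exact add_le_add hyd hsR
        _ = R + ε / 2 := by ring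
    obtain ⟨q', ⟨k, rfl⟩, hk⟩ := h1 y hy hyn
    refine ⟨k, ?_⟩
    rw [hkey]
    calc dist (x k - x i) (A (s - q)) ≤ dist (x k - x i) y + dist y (A (s - q)) :=
          dist_triangle _ _ _
      _ ≤ ε / 2 + ε / 2 := add_le_add hk hyd
      _ = ε := by ring
  · intro j hj
    have hq' : x j - x i ∈ Set.range (fun k : Fin N => x k - x i) := ⟨j, rfl⟩
    have hq'n : ‖x j - x i‖ ≤ R + ε / 2 := by
      rw [← dist_eq_norm]; linarith
    obtain ⟨p, hp, hpd⟩ := h2 _ hq' hq'n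
    have hpn : ‖p‖ ≤ R + ε / 2 := by
      calc ‖p‖ = dist p 0 := (dist_zero_right _).symm
        _ ≤ dist p (x j - x i) + dist (x j - x i) 0 := dist_triangle _ _ _
        _ ≤ ε / 2 + R := by
            rw [dist_zero_right, dist_comm, ← dist_eq_norm]; exact add_le_add hpd hj
        _ = R + ε / 2 := by ring
    obtain ⟨s, hs, hsd⟩ := hQ2 p hp hpn
    refine ⟨s, hs, ?_⟩
    rw [hkey]
    calc dist (x j - x i) (A (s - q)) ≤ dist (x j - x i) p + dist p (A (s - q)) :=
          dist_triangle _ _ _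
      _ ≤ ε / 2 + ε / 2 := add_le_add hpd hsd
      _ = ε := by ring

/-! ## The assembly of the split -/

/-- **The typed split of the hinge** (route `BenjaminiSchrammPeriodicSupport`, layer 2):
`PeriodicSupport → BenjaminiSchrammLimit → CrysEnergyLimit → GroundStatesChargePeriodic`.
Periodic support of the minimising point-stationary hard-core laws (the Palm-side crux), the
Benjamini–Schramm limit of the ground states (construction, proved) and the energy limit
`E(N)/N → e*` (proved) give ONE periodic configuration charged with positive density at every
scale, frequently in `N`. [AldousLyons2007 §2; AldousSteele2004; BlancLewin2015 §2.1] -/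
theorem GroundStatesChargePeriodic_of_subs :
    PeriodicSupport → BenjaminiSchrammLimit → CrysEnergyLimit → GroundStatesChargePeriodic := by
  intro hPS hBS hLim x hx
  obtain ⟨φ, hφ, δ, hδ, P, hP, hcore, hstat, hE, htr⟩ := hBS x hx
  -- the Benjamini–Schramm limit is minimising: `E_P[h] = lim E(φ j)/φ j = e*`
  have hlim' : Tendsto (fun j : ℕ => groundStateEnergy lennardJones 3 (φ j) / (φ j : ℝ)) atTop
      (𝓝 (⨅ Q : PeriodicConfiguration 3, Q.energyPerParticle lennardJones)) :=
    hLim.comp hφ.tendsto_atTop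
  have hEq := tendsto_nhds_unique hE hlim'
  -- fold the frame of `BenjaminiSchrammLimit` into the three landed notions
  have hcore' : ∀ᵐ μ ∂P, Literature.Probability.Process.IsRootedHardCore δ μ := hcore
  have hstat' : Literature.Probability.Process.IsPointStationaryLaw P := hstat
  have hmin : (∫ μ, rootEnergy lennardJones μ ∂P) ≤
      ⨅ Q : PeriodicConfiguration 3, Q.energyPerParticle lennardJones := hEq.le
  -- ONE periodic configuration charged at every scale
  obtain ⟨Q, hQ⟩ := hPS δ hδ P hP hcore' hstat' hmin
  refine ⟨Q, fun R ε hR hε => ?_⟩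
  -- the matching event at radius `R + ε/2`, tolerance `ε/2`
  set T : Set (Measure (EuclideanSpace ℝ (Fin 3))) :=
    {μ | ∃ A : EuclideanSpace ℝ (Fin 3) →ₗᵢ[ℝ] EuclideanSpace ℝ (Fin 3), ∃ q ∈ Q.points,
      (∀ s ∈ Q.points, dist s q ≤ R + ε / 2 →
        ∃ y : EuclideanSpace ℝ (Fin 3), μ {y} ≠ 0 ∧ dist y (A (s - q)) ≤ ε / 2) ∧
      (∀ y : EuclideanSpace ℝ (Fin 3), μ {y} ≠ 0 → ‖y‖ ≤ R + ε / 2 →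
        ∃ s ∈ Q.points, dist y (A (s - q)) ≤ ε / 2)} with hTdef
  have hT : 0 < P T := hQ (R + ε / 2) (ε / 2) (by positivity) (half_pos hε)
  have hTreal : 0 < (P T).toReal := ENNReal.toReal_pos hT.ne' (measure_ne_top P T)
  refine ⟨(P T).toReal / 2, half_pos hTreal, ?_⟩
  have hev := htr T (R + ε / 2) (ε / 2) (half_pos hε) ((P T).toReal / 2) (half_lt_self hTreal)
  -- the property transferred to `N = φ j`
  set good : (N : ℕ) → Fin N → Prop := fun N i =>
    ∃ A : EuclideanSpace ℝ (Fin 3) →ₗᵢ[ℝ] EuclideanSpace ℝ (Fin 3), ∃ q ∈ Q.points,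
      (∀ s ∈ Q.points, dist s q ≤ R → ∃ j : Fin N, dist (x N j) (x N i + A (s - q)) ≤ ε) ∧
      (∀ j : Fin N, dist (x N j) (x N i) ≤ R →
        ∃ s ∈ Q.points, dist (x N j) (x N i + A (s - q)) ≤ ε)
    with hgood
  have himp : ∀ (N : ℕ) (i : Fin N),
      (∃ ν ∈ T, ((∀ p : EuclideanSpace ℝ (Fin 3), ν {p} ≠ 0 → ‖p‖ ≤ R + ε / 2 →
          ∃ q ∈ (Set.range (fun k : Fin N => x N k - x N i)), dist q p ≤ ε / 2) ∧
        (∀ q ∈ (Set.range (fun k : Fin N => x N k - x N i)), ‖q‖ ≤ R + ε / 2 →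
          ∃ p : EuclideanSpace ℝ (Fin 3), ν {p} ≠ 0 ∧ dist q p ≤ ε / 2))) → good N i := by
    rintro N i ⟨ν, ⟨A, q, hq, hQ1, hQ2⟩, h1, h2⟩
    obtain ⟨c1, c2⟩ := matched_periodic_of_matched_event (x N) i Q hε.le ν A hQ1 hQ2 h1 h2
    exact ⟨A, q, hq, c1, c2⟩
  have hev' : ∀ᶠ j : ℕ in atTop,
      (P T).toReal / 2 * ((φ j : ℕ) : ℝ) ≤ (Nat.card {i : Fin (φ j) // good (φ j) i} : ℝ) := by
    filter_upwards [hev] with j hj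
    refine hj.trans ?_
    exact_mod_cast Nat.card_le_card_of_injective _
      (Subtype.map_injective (fun i hi => himp (φ j) i hi) Function.injective_id)
  exact hφ.tendsto_atTop.frequently
    (p := fun N : ℕ => (P T).toReal / 2 * (N : ℝ) ≤ (Nat.card {i : Fin N // good N i} : ℝ))
    hev'.frequently

/-- **Item stmt-AtomisticToContinuum-12748 (`SupportToHinge`)**, the route's glue of layer 2: its
middle antecedent is `BenjaminiSchrammLimit` written through the landed notions `IsRootedHardCore`,
`IsPointStationaryLaw` and `rootEnergy`, which unfold definitionally, so the split assembly
`GroundStatesChargePeriodic_of_subs` proves it verbatim. -/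
theorem supportToHinge_proof : SupportToHinge := by
  intro hPS hBS hLim
  exact GroundStatesChargePeriodic_of_subs hPS hBS hLim

end Summit.AtomisticToContinuum.Crystallization.Cruxes.GroundStatesChargePeriodic.Split
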